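import Mathlib
import HarnessLib
import Literature.MathematicalPhysics.KineticTheory.HardSphereEulerProofs
import Summits.AtomisticToContinuum.HydrodynamicLimit.Theses.OneFlightGossipEngine
import Summits.AtomisticToContinuum.HydrodynamicLimit.Theorems.OneFlightGossipEngineKineticCurrentsLDAlongFamiliesKCWUSharpPlus

/-!
# Skeleton v6 (ONE STUB) — crux `KineticCurrentsLDAlongFamilies` (stmt-AtomisticToContinuum-16659),
# line `Sketch` (lead prover-line-stmt-AtomisticToContinuum-16659-c3-0; continuation of -16659-0 / -c1-0 / -c2-0)

Line `Sketch` (cards `skolem-only-in-beta`, `identity-theorem-uniformiser`; ideator evidence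
`IdeatorTwoSketch.lean`): the family crux from the POINTWISE docking rung with a NUMERIC tilt
threshold `β₀ = β₀(Θ,U,C,Λ,σ)`, by a finite net in the family parameter `s`, a static one-body
change of reference law, one joint modulus of the class functional, and exponential tightness of
the window-averaged suprathermal kinetic energy at the net nodes obtained from the same rung for the
RADIAL sector of the class (static Gaussian re-orthogonalised dominator).

WHAT v6 CHANGES (cycle 4). v5b (lead -c2-0, sha 21b06663…) closed the crux modulo TWO registered
dynamical stubs, S1 `stub_kcwuSharp` (structured class `A(x):w⊗w + (b(x)·w)G(x,|w|²)`) and S1R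
`stub_kcwuSharpRadial` (radial sector `K(x,|w|²)`), and certified (p137412) that both are instances
of ONE statement, `KCWUSharpPlus` = the rung for the class ENLARGED by its radial sector,
`F = A(x):w⊗w + (b(x)·w)G(x,|w|²) + K(x,|w|²)`, `w = v − u₀(x)`, growth `C(1+‖v‖²)`,
`⊥ 1, v_j, ‖v‖²` under `M_{1,u₀(x),θ₀(x)}` at every `x`, with
`stub_kcwuSharpPlus_implies_crux : KCWUSharpPlus → KineticCurrentsLDAlongFamilies` LANDED
(`Theorems/OneFlightGossipEngineKineticCurrentsLDAlongFamiliesKCWUSharpPlus.lean`). v6 registers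
exactly that single statement as the line's ONE open stub, so that the crux, the disprover's target
and the planner's promotion candidate are one registered signature:

```
KineticCurrentsLDAlongFamilies_of :=
  stub_kcwuSharpPlus_implies_crux          -- LANDED p137412 (= S7' p137211 ∘ S9 p137070 ∘ S10 p136745 ∘ S8 p136419 ∘ S5 p129139 ∘ S6 p128108,
    stub_kcwuSharpPlus                     --   with S1 := K = 0 instance, S1R := A = b = G = 0 instance)
                                           -- S1+ OPEN: the pointwise kinetic-window LD rung, numeric β₀, class ⊕ radial sector
```

Status of the single stub: research-level and CRUX-SIZED — it implies the support rung stmt-14662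
`KineticCurrentsWindowLDUniform` outright (`kineticCurrentsWindowLDUniform_of_kcwuSharpPlus`,
p137412 ∘ p134390), while the crux itself implies 14662 (`rung_of_crux`, Disproof.lean §0 /
`Theorems/OneFlightGossipEngineKineticCurrentsWindowLDUniformOfFamilies.lean`): every line of this
crux contains the dynamical core of 14662 (kinetic relaxation of non-hydrodynamic one-body modes at
LD scale over `τ ≫ 1` mean free times, deterministic hard spheres, fixed reduced density; no print).
The incomparable alternative v4 (crux ⟸ S1 ∧ S2''b `stub_collisionalTransportFamily`) stays in the
tree history (commit 9f26add2c0df) and in `NOTES.md`.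

Disproof.lean (cdisprove-16659, 2026-08-16T22:06Z): NO KILL, `-- Targets: none`; its load-bearing
clauses (⊥ rows, growth, `∃ N₀` after `τ`, numeric `β₀ ≤ 1/(2ΘC)`, `0 < σ`) are carried verbatim by
the stub.
-/

noncomputable section

open MeasureTheory Set Filter
open scoped ENNReal Topology

namespace Summit.AtomisticToContinuum.HydrodynamicLimit.Cruxes.KineticCurrentsLDAlongFamilies.Sketch

open Literature.Analysis.FluidPDE (HardSphereFlow Config localMaxwellian canonicalDensity liouville)
open Literature.MathematicalPhysics.KineticTheory (T3 V3 hsDiameter localGibbsLaw localGibbsProfile)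
open Literature.Analysis.FluidPDE Literature.MathematicalPhysics.KineticTheory
open Summit.AtomisticToContinuum.HydrodynamicLimit.Theses.OneFlightGossipEngine
  (KineticCurrentsLDAlongFamilies KineticCurrentsWindowLDUniform)

/-! ## The open stub (the single dynamical input) -/

/-- S1+ — `KCWUSharpPlus`: THE POINTWISE DOCKING RUNG WITH A NUMERIC TILT THRESHOLD FOR THE CLASS
ENLARGED BY ITS RADIAL SECTOR (OPEN; = v5b's S1 `stub_kcwuSharp` and S1R `stub_kcwuSharpRadial` in
one statement). There is a packing guard `η₀ > 0` such that for all data bounds `(Θ, U, C, Λ)` and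
every `σ > 0` there is `β₀ = β₀(Θ,U,C,Λ,σ) > 0` serving EVERY continuous profile triple within the
bounds, every flow family, and every continuous weight quadruple `(A, b, G, K)` whose functional
`F = A(x):w⊗w + (b(x)·w)G(x,|w|²) + K(x,|w|²)`, `w = v − u₀(x)`, has growth `C(1+‖v‖²)` and is
orthogonal to `1, v_j, ‖v‖²` under `M_{1,u₀(x),θ₀(x)}` at every `x`: for `|β| ≤ β₀` and `ε > 0`
there are `τ₀` and, for `τ ≥ τ₀`, `N₀` with `∫ exp(β Σᵢ w⁻¹∫₀ʷ F(Φ_r z i) dr) dλ^N ≤ exp(ε(N+1))`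
for `N ≥ N₀`, `w = τ(N+1)^{-1/3}`, `λ^N = localGibbsLaw σ a u₀ θ₀ N (Φ N)`. Necessary:
`β₀ ≤ 1/(2ΘC)` (static Gaussian integrability; Disproof.lean). Implies 14662. -/
theorem stub_kcwuSharpPlus :
    ∃ η₀ : ℝ, 0 < η₀ ∧ ∀ (Θ U C Λ : ℝ), 1 ≤ Θ → 0 ≤ U → 0 ≤ C → 1 ≤ Λ → ∀ σ : ℝ, 0 < σ →
        ∃ β₀ : ℝ, 0 < β₀ ∧
        ∀ (a θ₀ : T3 → ℝ) (u₀ : T3 → V3), Continuous a → Continuous θ₀ → Continuous u₀ →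
        (∀ x, Λ⁻¹ ≤ a x ∧ a x ≤ Λ) → (∀ x, Θ⁻¹ ≤ θ₀ x ∧ θ₀ x ≤ Θ) → (∀ x, ‖u₀ x‖ ≤ U) →
        σ ^ 3 * (⨆ x, a x) ≤ η₀ * ∫ x, a x →
        ∀ Φ : (N : ℕ) →
          HardSphereFlow (Torus.geometry (Fin 3)) (hsDiameter σ N) (N + 1),
        ∀ (A : T3 → Fin 3 → Fin 3 → ℝ) (b : T3 → V3) (G K : T3 × ℝ → ℝ),
        Continuous A → Continuous b → Continuous G → Continuous K →
        ∀ F : T3 × V3 → ℝ, (∀ y, F y =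
          (∑ j : Fin 3, ∑ k : Fin 3, A y.1 j k * ((y.2 - u₀ y.1) j * (y.2 - u₀ y.1) k)) +
            (∑ j : Fin 3, b y.1 j * (y.2 - u₀ y.1) j) * G (y.1, ‖y.2 - u₀ y.1‖ ^ 2) +
            K (y.1, ‖y.2 - u₀ y.1‖ ^ 2)) →
        (∀ y, |F y| ≤ C * (1 + ‖y.2‖ ^ 2)) →
        (∀ x, ∫ v, F (x, v) * localMaxwellian 1 (θ₀ x) (u₀ x) v = 0) →
        (∀ x (j : Fin 3), ∫ v, F (x, v) * v j * localMaxwellian 1 (θ₀ x) (u₀ x) v = 0) →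
        (∀ x, ∫ v, F (x, v) * ‖v‖ ^ 2 * localMaxwellian 1 (θ₀ x) (u₀ x) v = 0) →
        ∀ β : ℝ, |β| ≤ β₀ → ∀ ε : ℝ, 0 < ε → ∃ τ₀ : ℝ, 0 < τ₀ ∧ ∀ τ : ℝ, τ₀ ≤ τ →
        ∃ N₀ : ℕ, ∀ N : ℕ, N₀ ≤ N →
          ∫⁻ z, ENNReal.ofReal (Real.exp (β * ∑ i : Fin (N + 1),
              (τ * ((N : ℝ) + 1) ^ (-(1 / 3 : ℝ)))⁻¹ *
                ∫ r in (0 : ℝ)..(τ * ((N : ℝ) + 1) ^ (-(1 / 3 : ℝ))), F (((Φ N).flow r z) i)))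
            ∂(localGibbsLaw σ a u₀ θ₀ N (Φ N)) ≤
          ENNReal.ofReal (Real.exp (ε * ((N : ℝ) + 1))) := by
  sorry

/-! ## Composition -/

/-- The line closes the crux modulo its single stub: `KCWUSharpPlus` fed into the LANDED
certificate `stub_kcwuSharpPlus_implies_crux` (p137412), which is the v5b composition — net
transfer S7' (p137211) ∘ family window tails S9 (p137070) ∘ pointwise radial tails S10 (p136745) ∘
static radial dominator S8 (p136419) ∘ static change of law S5 (p129139) ∘ family modulus S6
(p128108) — with S1 and S1R instantiated from the enlarged-class rung. This is the only theorem of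
the file whose conclusion is the crux constant. -/
theorem KineticCurrentsLDAlongFamilies_of : KineticCurrentsLDAlongFamilies :=
  Theorems.KineticCurrentsLDAlongFamiliesSketch.stub_kcwuSharpPlus_implies_crux stub_kcwuSharpPlus

-- The same stub also yields the support rung stmt-14662 (crux-sized by construction):
-- `Theorems.KineticCurrentsLDAlongFamiliesSketch.kineticCurrentsWindowLDUniform_of_kcwuSharpPlus stub_kcwuSharpPlus
--    : KineticCurrentsWindowLDUniform` (p137412 ∘ p134390; not declared here to keep `_of` the only item-prover).

end Summit.AtomisticToContinuum.HydrodynamicLimit.Cruxes.KineticCurrentsLDAlongFamilies.Sketch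

end
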